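import Summits.QuantumFields.QCD.Theorems.SpectralDefectExtinctionWindowExtinctionStubDetQuasilocalTorus

/-!
# Stub `stub_detQuasilocal` (S3) of line `free-volume-heavy-witness`
(crux `SpectralDefectExtinction.WindowExtinction`, item stmt-QuantumFields-8964)

**Quasi-locality of the phase-quenched fermionic weight.**  For masses `μ_f ∈ [lo, hi]`, `lo > 0`,
four `SU(3)` gauge fields `U, U₁, U₂, U₁₂` on the torus `(ℤ/n)⁴` — `U₁`/`U₂` agree with `U` off
the images of the boxes `c₁ + [-R,R]⁴` / `c₂ + [-R,R]⁴`, `U₁₂` is `U₁` on box 1 and `U₂` off it —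
with box centres `≥ 2R+1+s` apart in torus sup-distance (every periodic image), the mixed second
difference of `log ∏_f |det D_W(·, μ_f, 1)|` is `≤ C e^{-κ s}`, `κ = log((lo+4)/4) > 0`,
`C = N_f · 12(2R+3)⁴ · 64 (lo+4)/(4 lo²)`, uniformly in `n, c₁, c₂` and the fields.

Proof (per flavour, `D_X = D_W(U_X, m, 1)`, `G_X = D_X⁻¹`, `‖G_X‖ ≤ 1/m`, `V_i = D_i − D₀`).
§1 (general linear algebra): `‖det A‖ ≤ b^{dim}` if all eigenvalues have modulus `≤ b`; hence
`‖det(1 + K)‖ ≤ (1 + δ)^{|T|}` for `K` with rows supported in `T` and spectral radius `≤ δ`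
(block-triangular reduction); the resolvent algebra
`det D₁₂ · det D₀ = det D₁ · det D₂ · det(1 − V₂ G₁ V₁ G₂)` whenever `D₁₂ − D₁ − D₂ + D₀ = 0`.
§2 (assembly): `D_W` is affine in each link, so `D₁₂ − D₁ − D₂ + D₀ = 0`; both
`K = V₂ G₁ V₁ G₂` and its mirror `(D₁₂ − D₁) G₀ (D₀ − D₁) G₁₂` have rows in the `≤ 12(2R+3)⁴`
fermion indices over the fattened box 2 and norm `≤ δ = 64 (4/(lo+4))^{s-1}/lo²`, because the
sandwiched propagator only connects the two fattened boxes, `≥ s − 1` hops apart, through the tail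
of its convergent hopping expansion (`detQL_norm_sandwich_le`).  So
`|det D₁₂| |det D₀| / (|det D₁| |det D₂|) ∈ [(1+δ)^{-r₀}, (1+δ)^{r₀}]`, the mixed difference of logs is
`≤ r₀ log(1+δ) ≤ r₀ δ`, and one sums over the `N_f` flavours.

No definitions; pure theorem file serving the lead's skeleton `work/WindowExtinction.lean`.
-/

noncomputable section

namespace Summit.QuantumFields.QCD.Cruxes.WindowExtinction.FreeVolumeHeavyWitness

open Literature.MathematicalPhysics.QuantumLattice Literature.MathematicalPhysics.QuantumFieldTheory
  Literature.Probability.LatticeModels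
open MeasureTheory Matrix Filter Literature.MathematicalPhysics
open scoped BigOperators Matrix.Norms.L2Operator

/-! ## §1 General linear algebra -/

section LinearAlgebra
/-- **Determinant versus spectral radius**: if every eigenvalue of `A` has modulus `≤ b`, then
`‖det A‖ ≤ b ^ dim` (the determinant is the product of the `dim` roots of the characteristic
polynomial; each root has an eigenvector). -/
theorem detQL_norm_det_le_pow_of_eigenvalues {ι : Type*} [Fintype ι] [DecidableEq ι]
    (A : Matrix ι ι ℂ) {b : ℝ} (hb : 0 ≤ b)
    (h : ∀ (v : ι → ℂ) (z : ℂ), v ≠ 0 → A *ᵥ v = z • v → ‖z‖ ≤ b) :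
    ‖A.det‖ ≤ b ^ Fintype.card ι := by
  rw [Matrix.det_eq_prod_roots_charpoly, ← Matrix.charpoly_natDegree_eq_dim A,
    ← IsAlgClosed.card_roots_eq_natDegree]
  have hroot : ∀ z ∈ A.charpoly.roots, ‖z‖ ≤ b := fun z hz => by
    -- eigenvector of a root (as in Cruxes/WindowExtinction/Disproof.lean)
    have hspec : z ∈ spectrum ℂ A := Matrix.mem_spectrum_iff_isRoot_charpoly.2
      ((Polynomial.mem_roots A.charpoly_monic.ne_zero).1 hz)
    rw [spectrum.mem_iff, Matrix.isUnit_iff_isUnit_det, isUnit_iff_ne_zero, not_not] at hspec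
    obtain ⟨v, hv, hv0⟩ := Matrix.exists_mulVec_eq_zero_iff.2 hspec
    rw [Algebra.algebraMap_eq_smul_one, Matrix.sub_mulVec, Matrix.smul_mulVec, Matrix.one_mulVec,
      sub_eq_zero] at hv0
    exact h v z hv hv0.symm
  generalize A.charpoly.roots = s at hroot ⊢
  induction s using Multiset.induction_on with
  | empty => simp
  | cons a s ih =>
    rw [Multiset.prod_cons, Multiset.card_cons, pow_succ, norm_mul, mul_comm]
    exact mul_le_mul (ih fun z hz => hroot z (Multiset.mem_cons_of_mem hz))
      (hroot a (Multiset.mem_cons_self a s)) (norm_nonneg _) (pow_nonneg hb _)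

/-- **Block reduction of `det (1 + K)` for a row-supported perturbation.**  If the rows of `K`
vanish outside `T = {i | p i}` and every eigenvalue of `K` has modulus `≤ δ`, then
`‖det (1 + K)‖ ≤ (1 + δ) ^ |T|`: `1 + K` is block-triangular with identity `Tᶜ`-block, and an
eigenvector of the `T`-block of `K` extends by zero to an eigenvector of `K`. -/
theorem detQL_norm_det_one_add_le_pow_card {ι : Type*} [Fintype ι] [DecidableEq ι]
    (K : Matrix ι ι ℂ) (p : ι → Prop) [DecidablePred p] {δ : ℝ} (hδ : 0 ≤ δ)
    (hrow : ∀ i, ¬ p i → ∀ j, K i j = 0)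
    (heig : ∀ (v : ι → ℂ) (z : ℂ), v ≠ 0 → K *ᵥ v = z • v → ‖z‖ ≤ δ) :
    ‖(1 + K).det‖ ≤ (1 + δ) ^ Fintype.card {i // p i} := by
  have hblock := Matrix.twoBlockTriangular_det (1 + K) p (fun i hi j hj => by
    have hij : i ≠ j := fun h => hi (h ▸ hj)
    rw [Matrix.add_apply, Matrix.one_apply_ne hij, hrow i hi j, add_zero])
  have hcompl : Matrix.toSquareBlockProp (1 + K) (fun i => ¬ p i) = 1 := by
    ext i j
    rw [Matrix.toSquareBlockProp_def, Matrix.of_apply, Matrix.add_apply, hrow _ i.2, add_zero]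
    simp only [Matrix.one_apply, Subtype.ext_iff]
  have hK' : Matrix.toSquareBlockProp (1 + K) p = 1 + Matrix.toSquareBlockProp K p := by
    ext i j
    simp only [Matrix.toSquareBlockProp_def, Matrix.of_apply, Matrix.add_apply, Matrix.one_apply,
      Subtype.ext_iff]
  rw [hblock, hcompl, Matrix.det_one, mul_one, hK']
  refine detQL_norm_det_le_pow_of_eigenvalues _ (by linarith) fun v z hv hKv => ?_
  have hK'v : Matrix.toSquareBlockProp K p *ᵥ v = (z - 1) • v := by
    rw [Matrix.add_mulVec, Matrix.one_mulVec] at hKv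
    rw [sub_smul, one_smul, ← hKv, add_sub_cancel_left]
  -- extend `v` by zero
  set w : ι → ℂ := fun i => if h : p i then v ⟨i, h⟩ else 0 with hw
  have hw0 : w ≠ 0 := by
    intro h0
    apply hv
    funext i
    have := congr_fun h0 i.1
    simpa only [hw, dif_pos i.2, Pi.zero_apply] using this
  have hsum : ∀ i, ∑ j, K i j * w j = ∑ j : {x // p x}, K i j * v j := by
    intro i
    rw [← Fintype.sum_subtype_add_sum_subtype p (fun j => K i j * w j)]
    have h2 : ∑ j : {x // ¬ p x}, K i j * w j = 0 :=
      Finset.sum_eq_zero fun j _ => by simp only [hw, dif_neg j.2, mul_zero]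
    rw [h2, add_zero]
    refine Finset.sum_congr rfl fun j _ => ?_
    simp only [hw, dif_pos j.2]
  have hKw : K *ᵥ w = (z - 1) • w := by
    funext i
    simp only [Matrix.mulVec, dotProduct, Pi.smul_apply, smul_eq_mul]
    rw [hsum i]
    by_cases hi : p i
    · have := congr_fun hK'v ⟨i, hi⟩
      simp only [Matrix.mulVec, dotProduct, Matrix.toSquareBlockProp_def, Matrix.of_apply,
        Pi.smul_apply, smul_eq_mul] at this
      rw [this]
      simp only [hw, dif_pos hi]
    · rw [Finset.sum_eq_zero fun j _ => by rw [hrow i hi, zero_mul]]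
      simp only [hw, dif_neg hi, mul_zero]
  have hz := heig w (z - 1) hw0 hKw
  calc ‖z‖ = ‖(z - 1) + 1‖ := by rw [sub_add_cancel]
    _ ≤ ‖z - 1‖ + ‖(1 : ℂ)‖ := norm_add_le _ _
    _ ≤ δ + 1 := by rw [norm_one]; exact add_le_add hz le_rfl
    _ = 1 + δ := add_comm _ _

/-- **The algebra of the mixed second difference of `log det`.**  If `A₁ G₁ = G₁ A₁ = 1`,
`A₂ G₂ = 1` and `A₁₂ − A₁ − A₂ + A₀ = 0`, then with `V_i = A_i − A₀`: `A₁₂ G₁ = 1 + V₂ G₁`,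
`A₀ G₂ = 1 − V₂ G₂`, `(1 + V₂ G₁)(1 − V₂ G₂) = 1 − V₂ G₁ V₁ G₂` (resolvent identity), whence
`det A₁₂ · det A₀ = det A₁ · det A₂ · det (1 − V₂ G₁ V₁ G₂)`. -/
theorem detQL_det_mixed_mul_eq {ι : Type*} [Fintype ι] [DecidableEq ι]
    (A₀ A₁ A₂ A₁₂ G₁ G₂ : Matrix ι ι ℂ) (h₁ : A₁ * G₁ = 1) (h₁' : G₁ * A₁ = 1) (h₂ : A₂ * G₂ = 1)
    (hmix : A₁₂ - A₁ - A₂ + A₀ = 0) :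
    A₁₂.det * A₀.det =
      A₁.det * A₂.det * (1 - (A₂ - A₀) * G₁ * (A₁ - A₀) * G₂).det := by
  have hA₁₂ : A₁₂ = A₁ + (A₂ - A₀) := by
    rw [← sub_eq_zero, ← hmix]; abel
  have e1 : A₁₂ * G₁ = 1 + (A₂ - A₀) * G₁ := by rw [hA₁₂, add_mul, h₁]
  have e2 : A₀ * G₂ = 1 - (A₂ - A₀) * G₂ := by rw [sub_mul, h₂, sub_sub_cancel]
  have e3 : G₁ - G₂ = G₁ * ((A₂ - A₀) - (A₁ - A₀)) * G₂ := by
    rw [sub_sub_sub_cancel_right, mul_sub, sub_mul, mul_assoc, h₂, mul_one, h₁', one_mul]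
  have key : (1 + (A₂ - A₀) * G₁) * (1 - (A₂ - A₀) * G₂) =
      1 - (A₂ - A₀) * G₁ * (A₁ - A₀) * G₂ := by
    have : (1 + (A₂ - A₀) * G₁) * (1 - (A₂ - A₀) * G₂) - (1 - (A₂ - A₀) * G₁ * (A₁ - A₀) * G₂) =
        (A₂ - A₀) * (G₁ - G₂ - G₁ * ((A₂ - A₀) - (A₁ - A₀)) * G₂) := by
      noncomm_ring
    rwa [← e3, sub_self, mul_zero, sub_eq_zero] at this
  have d1 : A₁.det * G₁.det = 1 := by rw [← det_mul, h₁, det_one]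
  have d2 : A₂.det * G₂.det = 1 := by rw [← det_mul, h₂, det_one]
  rw [← key, ← e1, ← e2, det_mul, det_mul, det_mul]
  linear_combination (-(A₁₂.det * A₀.det * (A₂.det * G₂.det))) * d1 - (A₁₂.det * A₀.det) * d2

/-- Two-sided multiplicative comparison of positive reals bounds the difference of logarithms:
`a ≤ b t` and `b ≤ a t` give `|log a − log b| ≤ log t`. -/
theorem detQL_abs_log_sub_log_le {a b t : ℝ} (ha : 0 < a) (hb : 0 < b) (h1 : a ≤ b * t)
    (h2 : b ≤ a * t) : |Real.log a - Real.log b| ≤ Real.log t := by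
  have ht : 0 < t := lt_of_not_ge fun h => by nlinarith
  rw [abs_le]
  constructor
  · have := Real.log_le_log hb h2
    rw [Real.log_mul ha.ne' ht.ne'] at this
    linarith
  · have := Real.log_le_log ha h1
    rw [Real.log_mul hb.ne' ht.ne'] at this
    linarith

end LinearAlgebra

/-! ## §2 Assembly on the torus -/

section Assembly

variable {n : ℕ} [NeZero n]

/-- **Quasi-locality of `log |det D_W(·, m, 1)|` for one flavour.**  For `0 < lo ≤ m`, two box
surgeries `U ↦ U₁` (box `c₁ + [-R,R]⁴`) and `U ↦ U₂` (box `c₂ + [-R,R]⁴`) whose centres are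
`≥ 2R+1+s` apart in torus sup-distance, and `U₁₂` carrying both, the mixed second difference of
`log |det D_W|` is at most `12 (2R+3)⁴ · 64 (4/(lo+4))^{s-1} / lo²`. -/
theorem detQL_abs_mixed_log_norm_det_le (R : ℕ) {lo : ℝ} (hlo : 0 < lo) (c₁ c₂ : Fin 4 → ℤ) (s : ℕ)
    (hsep : ∀ q : Fin 4 → ℤ, ∃ j : Fin 4, ((2 * R + 1 + s : ℕ) : ℤ) ≤ |c₁ j - c₂ j - q j * n|)
    {m : ℝ} (hm : lo ≤ m) (U U₁ U₂ U₁₂ : GaugeConfig 4 n SU3)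
    (h1 : ∀ e, (¬ ∃ y : ↥(box 4 R), Torus.proj n (c₁ + (y : Fin 4 → ℤ)) = e.1) → U₁ e = U e)
    (h2 : ∀ e, (¬ ∃ y : ↥(box 4 R), Torus.proj n (c₂ + (y : Fin 4 → ℤ)) = e.1) → U₂ e = U e)
    (h3 : ∀ e, (∃ y : ↥(box 4 R), Torus.proj n (c₁ + (y : Fin 4 → ℤ)) = e.1) → U₁₂ e = U₁ e)
    (h4 : ∀ e, (¬ ∃ y : ↥(box 4 R), Torus.proj n (c₁ + (y : Fin 4 → ℤ)) = e.1) → U₁₂ e = U₂ e) :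
    |Real.log ‖(wilsonDirac (fundamentalRep (Fin 3)) U₁₂ m 1).det‖ -
        Real.log ‖(wilsonDirac (fundamentalRep (Fin 3)) U₁ m 1).det‖ -
        Real.log ‖(wilsonDirac (fundamentalRep (Fin 3)) U₂ m 1).det‖ +
        Real.log ‖(wilsonDirac (fundamentalRep (Fin 3)) U m 1).det‖| ≤
      (12 * (2 * (R + 1) + 1) ^ 4 : ℕ) * (8 * (4 / (lo + 4)) ^ (s - 1) * lo⁻¹ * 8 * lo⁻¹) := by
  have hρ : ∀ g, fundamentalRep (Fin 3) g ∈ Matrix.unitaryGroup (Fin 3) ℂ :=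
    fundamentalRep_mem_unitaryGroup
  have hm0 : 0 < m := hlo.trans_le hm
  -- the four operators and their inverses
  set D₀ := wilsonDirac (fundamentalRep (Fin 3)) U m 1 with hD₀
  set D₁ := wilsonDirac (fundamentalRep (Fin 3)) U₁ m 1 with hD₁
  set D₂ := wilsonDirac (fundamentalRep (Fin 3)) U₂ m 1 with hD₂
  set D₁₂ := wilsonDirac (fundamentalRep (Fin 3)) U₁₂ m 1 with hD₁₂
  obtain ⟨hu0, hG0⟩ :=
    detQL_isUnit_det_wilsonDirac_and_norm_inv_le (fundamentalRep (Fin 3)) hρ U hm0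
  obtain ⟨hu1, hG1⟩ :=
    detQL_isUnit_det_wilsonDirac_and_norm_inv_le (fundamentalRep (Fin 3)) hρ U₁ hm0
  obtain ⟨hu2, hG2⟩ :=
    detQL_isUnit_det_wilsonDirac_and_norm_inv_le (fundamentalRep (Fin 3)) hρ U₂ hm0
  obtain ⟨hu12, hG12⟩ :=
    detQL_isUnit_det_wilsonDirac_and_norm_inv_le (fundamentalRep (Fin 3)) hρ U₁₂ hm0
  have hmlo : m⁻¹ ≤ lo⁻¹ := inv_anti₀ hlo hm
  -- disjointness of the two box images
  have hdisj : ∀ x : TorusSite 4 n, (∃ y : ↥(box 4 R), Torus.proj n (c₁ + (y : Fin 4 → ℤ)) = x) →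
      ¬ ∃ y : ↥(box 4 R), Torus.proj n (c₂ + (y : Fin 4 → ℤ)) = x := by
    rintro x ⟨y₁, hy₁⟩ ⟨y₂, hy₂⟩
    obtain ⟨j, hj⟩ := detQL_exists_coord_far c₁ c₂ R R (1 + s)
      (fun q => (hsep q).imp fun j hj => le_of_eq_of_le (by push_cast; ring) hj) y₁.2 y₂.2
    rw [hy₁, hy₂, sub_self, ZMod.valMinAbs_zero, Int.natAbs_zero] at hj
    omega
  -- link-by-link pairing of the four fields, hence `D₁₂ - D₁ - D₂ + D₀ = 0`
  have hE : ∀ e : TorusSite 4 n × Fin 4,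
      (U₁₂ e = U₁ e ∧ U₂ e = U e) ∨ (U₁₂ e = U₂ e ∧ U₁ e = U e) := by
    intro e
    by_cases hx : ∃ y : ↥(box 4 R), Torus.proj n (c₁ + (y : Fin 4 → ℤ)) = e.1
    · exact Or.inl ⟨h3 e hx, h2 e (hdisj _ hx)⟩
    · exact Or.inr ⟨h4 e hx, h1 e hx⟩
  have hmix : D₁₂ - D₁ - D₂ + D₀ = 0 :=
    detQL_wilsonDirac_mixed_eq_zero (fundamentalRep (Fin 3)) U₁₂ U₁ U₂ U m 1 hE
  have hmix' : D₂ - D₀ - D₁₂ + D₁ = 0 := by rw [← neg_eq_zero, ← hmix]; abel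
  -- agreement of `U₁₂` with `U₁` off box 2
  have h13 : ∀ e : TorusSite 4 n × Fin 4,
      (¬ ∃ y : ↥(box 4 R), Torus.proj n (c₂ + (y : Fin 4 → ℤ)) = e.1) → U₁₂ e = U₁ e := by
    intro e he
    by_cases hx : ∃ y : ↥(box 4 R), Torus.proj n (c₁ + (y : Fin 4 → ℤ)) = e.1
    · exact h3 e hx
    · rw [h4 e hx, h2 e he, h1 e hx]
  -- supports of the differences
  have hsub : ∀ (X Y : GaugeConfig 4 n SU3) (c : Fin 4 → ℤ),
      (∀ e : TorusSite 4 n × Fin 4, (¬ ∃ y : ↥(box 4 R), Torus.proj n (c + (y : Fin 4 → ℤ)) = e.1) →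
        X e = Y e) → ∀ i j : TorusSite 4 n × Fin 3 × Fin 4,
      ((¬ ∃ y : ↥(box 4 (R + 1)), Torus.proj n (c + (y : Fin 4 → ℤ)) = i.1) ∨
        ¬ ∃ y : ↥(box 4 (R + 1)), Torus.proj n (c + (y : Fin 4 → ℤ)) = j.1) →
      (wilsonDirac (fundamentalRep (Fin 3)) X m 1 - wilsonDirac (fundamentalRep (Fin 3)) Y m 1) i j = 0 := by
    intro X Y c hXY i j hij
    obtain ⟨hT0, hT1, hT2⟩ := detQL_box_image_closure (n := n) c R
    exact detQL_wilsonDirac_sub_apply_eq_zero (fundamentalRep (Fin 3)) X Y m 1 _ _ hXY hT0 hT1 hT2 i j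
      (fun h => hij.elim (fun h' => h' h.1) (fun h' => h' h.2))
  have h11 : ∀ e : TorusSite 4 n × Fin 4,
      (¬ ∃ y : ↥(box 4 R), Torus.proj n (c₁ + (y : Fin 4 → ℤ)) = e.1) → U e = U₁ e :=
    fun e he => (h1 e he).symm
  -- separation of the fattened boxes: `≥ s - 1` in some cyclic coordinate
  have hfar : ∀ r t : TorusSite 4 n × Fin 3 × Fin 4,
      (∃ y : ↥(box 4 (R + 1)), Torus.proj n (c₂ + (y : Fin 4 → ℤ)) = r.1) →
      (∃ y : ↥(box 4 (R + 1)), Torus.proj n (c₁ + (y : Fin 4 → ℤ)) = t.1) →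
      ∃ i : Fin 4, s - 1 ≤ (r.1 i - t.1 i).valMinAbs.natAbs := by
    rintro r t ⟨y₂, hy₂⟩ ⟨y₁, hy₁⟩
    rcases Nat.eq_zero_or_pos s with hs | hs
    · exact ⟨0, by rw [hs]; exact Nat.zero_le _⟩
    · obtain ⟨j, hj⟩ := detQL_exists_coord_far c₁ c₂ (R + 1) (R + 1) (s - 1)
        (fun q => (hsep q).imp fun j hj =>
          le_of_eq_of_le (by push_cast [Nat.cast_sub hs]; ring) hj) y₁.2 y₂.2
      rw [hy₁, hy₂] at hj
      exact ⟨j, hj⟩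
  -- the two sandwich bounds
  set δ : ℝ := 8 * (4 / (lo + 4)) ^ (s - 1) * lo⁻¹ * 8 * lo⁻¹ with hδ
  have hδ0 : 0 ≤ δ := by positivity
  have h8 := detQL_norm_wilsonDirac_sub_le (fundamentalRep (Fin 3)) hρ (n := n) (m := m)
  have hK : ‖(D₂ - D₀) * D₁⁻¹ * (D₁ - D₀) * D₂⁻¹‖ ≤ δ :=
    detQL_norm_sandwich_le (fundamentalRep (Fin 3)) hρ U₁ hlo hm (D₁ - D₀) (D₂ - D₀) D₂⁻¹ _ _
      (s - 1) (fun i j hj => hsub U₂ U c₂ h2 i j (Or.inr hj))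
      (fun i j hi => hsub U₁ U c₁ h1 i j (Or.inl hi)) hfar (h8 U₂ U) (h8 U₁ U) (hG2.trans hmlo)
  have hK' : ‖(D₁₂ - D₁) * D₀⁻¹ * (D₀ - D₁) * D₁₂⁻¹‖ ≤ δ :=
    detQL_norm_sandwich_le (fundamentalRep (Fin 3)) hρ U hlo hm (D₀ - D₁) (D₁₂ - D₁) D₁₂⁻¹ _ _
      (s - 1) (fun i j hj => hsub U₁₂ U₁ c₂ h13 i j (Or.inr hj))
      (fun i j hi => hsub U U₁ c₁ h11 i j (Or.inl hi)) hfar (h8 U₁₂ U₁) (h8 U U₁) (hG12.trans hmlo)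
  -- determinant identities
  have hdetA := detQL_det_mixed_mul_eq D₀ D₁ D₂ D₁₂ D₁⁻¹ D₂⁻¹ (Matrix.mul_nonsing_inv _ hu1)
    (Matrix.nonsing_inv_mul _ hu1) (Matrix.mul_nonsing_inv _ hu2) hmix
  have hdetB := detQL_det_mixed_mul_eq D₁ D₀ D₁₂ D₂ D₀⁻¹ D₁₂⁻¹ (Matrix.mul_nonsing_inv _ hu0)
    (Matrix.nonsing_inv_mul _ hu0) (Matrix.mul_nonsing_inv _ hu12) hmix'
  -- block bound on the perturbation determinants
  set r₀ : ℕ := 12 * (2 * (R + 1) + 1) ^ 4 with hr₀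
  have hcard := detQL_card_boxIndex_le (n := n) c₂ (R + 1)
  have hblock : ∀ K : Matrix (TorusSite 4 n × Fin 3 × Fin 4) (TorusSite 4 n × Fin 3 × Fin 4) ℂ,
      ‖K‖ ≤ δ → (∀ i j, (¬ ∃ y : ↥(box 4 (R + 1)), Torus.proj n (c₂ + (y : Fin 4 → ℤ)) = i.1) →
        K i j = 0) → ‖(1 - K).det‖ ≤ (1 + δ) ^ r₀ := by
    intro K hKδ hKrow
    rw [sub_eq_add_neg]
    refine (detQL_norm_det_one_add_le_pow_card (-K)
      (fun p : TorusSite 4 n × Fin 3 × Fin 4 =>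
        ∃ y : ↥(box 4 (R + 1)), Torus.proj n (c₂ + (y : Fin 4 → ℤ)) = p.1)
      hδ0 (fun i hi j => by rw [Matrix.neg_apply, hKrow i j hi, neg_zero])
      (fun v z hv hKv => ((detQL_norm_eigenvalue_le_opNorm (-K) hv hKv).trans
        (by rw [norm_neg]; exact hKδ)))).trans ?_
    exact pow_le_pow_right₀ (by linarith) hcard
  have hrowA : ∀ i j, (¬ ∃ y : ↥(box 4 (R + 1)), Torus.proj n (c₂ + (y : Fin 4 → ℤ)) = i.1) →
      ((D₂ - D₀) * D₁⁻¹ * (D₁ - D₀) * D₂⁻¹) i j = 0 := fun i j hi =>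
    detQL_mul_apply_eq_zero_of_row (fun r => detQL_mul_apply_eq_zero_of_row
      (fun r' => detQL_mul_apply_eq_zero_of_row (fun r'' => hsub U₂ U c₂ h2 i r'' (Or.inl hi)) r') r) j
  have hrowB : ∀ i j, (¬ ∃ y : ↥(box 4 (R + 1)), Torus.proj n (c₂ + (y : Fin 4 → ℤ)) = i.1) →
      ((D₁₂ - D₁) * D₀⁻¹ * (D₀ - D₁) * D₁₂⁻¹) i j = 0 := fun i j hi =>
    detQL_mul_apply_eq_zero_of_row (fun r => detQL_mul_apply_eq_zero_of_row
      (fun r' => detQL_mul_apply_eq_zero_of_row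
        (fun r'' => hsub U₁₂ U₁ c₂ h13 i r'' (Or.inl hi)) r') r) j
  have hbA := hblock _ hK hrowA
  have hbB := hblock _ hK' hrowB
  -- positivity of the determinants
  have hpos : ∀ {M : Matrix (TorusSite 4 n × Fin 3 × Fin 4) (TorusSite 4 n × Fin 3 × Fin 4) ℂ},
      IsUnit M.det → 0 < ‖M.det‖ := fun h => norm_pos_iff.2 h.ne_zero
  have ha : 0 < ‖D₁₂.det‖ * ‖D₀.det‖ := mul_pos (hpos hu12) (hpos hu0)
  have hb : 0 < ‖D₁.det‖ * ‖D₂.det‖ := mul_pos (hpos hu1) (hpos hu2)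
  have hineqA : ‖D₁₂.det‖ * ‖D₀.det‖ ≤ ‖D₁.det‖ * ‖D₂.det‖ * (1 + δ) ^ r₀ := by
    rw [← norm_mul, ← norm_mul, hdetA, norm_mul]
    exact mul_le_mul_of_nonneg_left hbA (norm_nonneg _)
  have hineqB : ‖D₁.det‖ * ‖D₂.det‖ ≤ ‖D₁₂.det‖ * ‖D₀.det‖ * (1 + δ) ^ r₀ := by
    rw [← norm_mul, ← norm_mul, mul_comm D₁.det, hdetB, norm_mul, mul_comm D₀.det]
    exact mul_le_mul_of_nonneg_left hbB (norm_nonneg _)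
  have hlog := detQL_abs_log_sub_log_le ha hb hineqA hineqB
  rw [Real.log_mul (hpos hu12).ne' (hpos hu0).ne', Real.log_mul (hpos hu1).ne' (hpos hu2).ne',
    Real.log_pow] at hlog
  have hlog1 : Real.log (1 + δ) ≤ δ := by
    have := Real.log_le_sub_one_of_pos (by linarith : 0 < 1 + δ)
    linarith
  calc |Real.log ‖D₁₂.det‖ - Real.log ‖D₁.det‖ - Real.log ‖D₂.det‖ + Real.log ‖D₀.det‖|
      = |Real.log ‖D₁₂.det‖ + Real.log ‖D₀.det‖ - (Real.log ‖D₁.det‖ + Real.log ‖D₂.det‖)| := by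
        ring_nf
    _ ≤ r₀ * Real.log (1 + δ) := hlog
    _ ≤ r₀ * δ := mul_le_mul_of_nonneg_left hlog1 (Nat.cast_nonneg _)

/-- **STUB S3 · quasi-locality of the fermionic weight** (`DetQuasilocal`): the mixed second
difference of `log ∏_f |det D_W(·, μ_f, 1)|` under surgeries in two boxes at torus distance `s` is
`≤ C e^{-κ s}` with `κ = log((lo+4)/4)` and `C = C(N_f, R, lo)`, uniformly in the volume, the
positions, the environment and the contents. -/
theorem stub_detQuasilocal :
    ∀ (Nf R : ℕ) (lo hi : ℝ), 0 < lo → lo ≤ hi → ∃ C κ : ℝ, 0 < κ ∧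
      ∀ (n : ℕ) [NeZero n] (c₁ c₂ : Fin 4 → ℤ) (s : ℕ),
        (∀ q : Fin 4 → ℤ, ∃ j : Fin 4, ((2 * R + 1 + s : ℕ) : ℤ) ≤ |c₁ j - c₂ j - q j * n|) →
        ∀ (μ : Fin Nf → ℝ), (∀ f, lo ≤ μ f ∧ μ f ≤ hi) →
          ∀ (U U₁ U₂ U₁₂ : GaugeConfig 4 n SU3),
            (∀ e, (¬ ∃ y : ↥(box 4 R), Torus.proj n (c₁ + (y : Fin 4 → ℤ)) = e.1) → U₁ e = U e) →
            (∀ e, (¬ ∃ y : ↥(box 4 R), Torus.proj n (c₂ + (y : Fin 4 → ℤ)) = e.1) → U₂ e = U e) →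
            (∀ e, (∃ y : ↥(box 4 R), Torus.proj n (c₁ + (y : Fin 4 → ℤ)) = e.1) → U₁₂ e = U₁ e) →
            (∀ e, (¬ ∃ y : ↥(box 4 R), Torus.proj n (c₁ + (y : Fin 4 → ℤ)) = e.1) → U₁₂ e = U₂ e) →
            |Real.log (∏ f : Fin Nf, ‖fermionDet (wilsonDirac (fundamentalRep (Fin 3)) U₁₂ (μ f) 1)‖) -
                Real.log (∏ f : Fin Nf, ‖fermionDet (wilsonDirac (fundamentalRep (Fin 3)) U₁ (μ f) 1)‖) -
                Real.log (∏ f : Fin Nf, ‖fermionDet (wilsonDirac (fundamentalRep (Fin 3)) U₂ (μ f) 1)‖) +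
                Real.log (∏ f : Fin Nf, ‖fermionDet (wilsonDirac (fundamentalRep (Fin 3)) U (μ f) 1)‖)| ≤
              C * Real.exp (-(κ * s)) := by
  intro Nf R lo hi hlo _hlohi
  set r₀ : ℕ := 12 * (2 * (R + 1) + 1) ^ 4 with hr₀
  set θ : ℝ := 4 / (lo + 4) with hθ
  have hθ0 : 0 < θ := by positivity
  have hθ1 : θ ≤ 1 := by rw [hθ, div_le_one (by linarith)]; linarith
  have hκ : 0 < Real.log ((lo + 4) / 4) :=
    Real.log_pos (by rw [lt_div_iff₀ (by norm_num)]; linarith)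
  refine ⟨Nf * (r₀ * (8 * θ⁻¹ * lo⁻¹ * 8 * lo⁻¹)), Real.log ((lo + 4) / 4), hκ, ?_⟩
  intro n _ c₁ c₂ s hsep μ hμ U U₁ U₂ U₁₂ h1 h2 h3 h4
  have hρ : ∀ g, fundamentalRep (Fin 3) g ∈ Matrix.unitaryGroup (Fin 3) ℂ :=
    fundamentalRep_mem_unitaryGroup
  have hdet : ∀ (X : GaugeConfig 4 n SU3) (f : Fin Nf),
      ‖fermionDet (wilsonDirac (fundamentalRep (Fin 3)) X (μ f) 1)‖ ≠ 0 := fun X f =>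
    norm_ne_zero_iff.2 (wilsonDirac_det_ne_zero_of_pos (fundamentalRep (Fin 3)) hρ X
      (hlo.trans_le (hμ f).1))
  rw [Real.log_prod (fun f _ => hdet U₁₂ f), Real.log_prod (fun f _ => hdet U₁ f),
    Real.log_prod (fun f _ => hdet U₂ f), Real.log_prod (fun f _ => hdet U f),
    ← Finset.sum_sub_distrib, ← Finset.sum_sub_distrib, ← Finset.sum_add_distrib]
  refine (Finset.abs_sum_le_sum_abs _ _).trans ?_
  -- `θ^{s-1} ≤ θ⁻¹ e^{-κ s}` with `e^{-κ s} = θ^s`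
  have hexp : Real.exp (-(Real.log ((lo + 4) / 4) * s)) = θ ^ s := by
    rw [show (lo + 4) / 4 = θ⁻¹ by rw [hθ, inv_div], Real.log_inv, neg_mul, neg_neg, mul_comm,
      Real.exp_nat_mul, Real.exp_log hθ0]
  have hθs : θ ^ (s - 1) ≤ θ⁻¹ * Real.exp (-(Real.log ((lo + 4) / 4) * s)) := by
    rw [hexp]
    rcases Nat.eq_zero_or_pos s with hs | hs
    · rw [hs, pow_zero, mul_one]
      exact (one_le_inv₀ hθ0).2 hθ1
    · obtain ⟨k, rfl⟩ := Nat.exists_eq_add_of_le' hs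
      rw [Nat.add_sub_cancel, pow_succ, mul_comm (θ ^ k) θ, ← mul_assoc, inv_mul_cancel₀ hθ0.ne',
        one_mul]
  calc ∑ f : Fin Nf, |Real.log ‖fermionDet (wilsonDirac (fundamentalRep (Fin 3)) U₁₂ (μ f) 1)‖ -
          Real.log ‖fermionDet (wilsonDirac (fundamentalRep (Fin 3)) U₁ (μ f) 1)‖ -
          Real.log ‖fermionDet (wilsonDirac (fundamentalRep (Fin 3)) U₂ (μ f) 1)‖ +
          Real.log ‖fermionDet (wilsonDirac (fundamentalRep (Fin 3)) U (μ f) 1)‖|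
      ≤ ∑ _f : Fin Nf, (r₀ : ℝ) * (8 * θ ^ (s - 1) * lo⁻¹ * 8 * lo⁻¹) :=
        Finset.sum_le_sum fun f _ =>
          detQL_abs_mixed_log_norm_det_le R hlo c₁ c₂ s hsep (hμ f).1 U U₁ U₂ U₁₂ h1 h2 h3 h4
    _ = Nf * (r₀ * (8 * θ ^ (s - 1) * lo⁻¹ * 8 * lo⁻¹)) := by
        rw [Finset.sum_const, Finset.card_univ, Fintype.card_fin, nsmul_eq_mul]
    _ ≤ Nf * (r₀ * (8 * (θ⁻¹ * Real.exp (-(Real.log ((lo + 4) / 4) * s))) * lo⁻¹ * 8 * lo⁻¹)) := by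
        gcongr
    _ = Nf * (r₀ * (8 * θ⁻¹ * lo⁻¹ * 8 * lo⁻¹)) * Real.exp (-(Real.log ((lo + 4) / 4) * s)) := by
        ring

end Assembly

end Summit.QuantumFields.QCD.Cruxes.WindowExtinction.FreeVolumeHeavyWitness

end
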